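import Mathlib
import Summits.NavierStokesRegularity.NavierStokesRegularity.Theorems.SubOnsagerCeilingKPSideBranchClassDynamics
import Summits.NavierStokesRegularity.NavierStokesRegularity.Theorems.SubOnsagerCeilingKPFluxBudget
import HarnessLib

/-!
# STARVED NETWORKS, GENERAL FORM — mechanism file (energy starvation with an arbitrary live/pocket partition,
# in-shell PUMPS and forward LEAKS into the pockets simultaneously; part 1 of 2)
# (helper file for the crux `SubOnsagerCeiling.ForwardTailCeilingKP`, stmt-NavierStokesRegularity-27057, `--supports`)

THE STARVED CLASS (def-free, by coefficient hypotheses on a KP network proper `α ∈ E₂(R)`: symmetric, cancelling, orthant,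
diagonal feeds).  A set `Q ⊆ Fin 4` of POCKETS is forward-dead and pump-dead (`α d d e (0,0,1) = 0` and `P d e = 0` for `d ∈ Q`,
where `P a e = α a a e (0,0,0)` is the pump matrix); the LIVE modes `a ∉ Q` carry an ARBITRARY diagonal forward network among
themselves (weights `w_{ae} = α a a e (0,0,1) ≥ 0`: chains, re-entry pairs, cycles, fans, merging), LEAK forward into the pockets
(weights `w_{ad}`, `d ∈ Q`) and PUMP in-shell into the pockets (weights `P a d`, `d ∈ Q`); live modes pump nothing else
(`P a e = 0` for `e ∉ Q`) and there are no differential triads (`α a b d (0,0,0) = 0` for `a, b, d` distinct).  This is the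
common generalisation of every energy-starvation corner landed so far (`…KPDeadEndPump*`, `…KPLeakSpray*`, `…KPExitSpray*`,
`…KPPairExit*`, `…KPSharedPocket*` = pumps only, `…KPLeakPocket*` = leaks only): several pockets, pumps AND leaks at once.

* `starved_pump_diag`, `starved_coeff`, `starved_inShell` — the in-shell coefficient table is determined by the pump matrix:
  `Σ_{a,b} α a b i (0,0,0) y_a y_b = Σ_a P a i·y_a² − y_i·Σ_j P i j·y_j`;
* `starved_quadTerm` (every mode), `starved_quadTerm_pocket` (`d ∈ Q`: `Λ_{n-1}Σ_a w_{ad}x²_{a,n-1} + Λₙ Σ_a P a d·x²_{a,n}`, no drain),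
  `starved_quadTerm_live` (`e ∉ Q`: `Λ_{n-1}Σ_a w_{ae}x²_{a,n-1} − Λₙ x_{e,n}Σ_j w_{ej}x_{j,n+1} − Λₙ x_{e,n}Σ_j P e j·x_{j,n}`);
* `starved_domination` — the GRAM DOMINATION LEMMA: if `r·Σ_{e∉Q} w_{ae}w_{ce} ≤ Σ_{d∈Q} (P a d·P c d + w_{ad}w_{cd})` for all live
  `a, c`, then along every honest non-negative `ν`-viscous solution from a one-shell datum, for every live `a`, every shell `N ≥ 1`
  and `t ∈ [0,s]`: `r·Σ_{e∉Q} w_{ae}·x_{e,N+1}(t) ≤ Σ_{d∈Q} (P a d·x_{d,N}(t) + w_{ad}·x_{d,N+1}(t))` — the pockets, which only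
  accumulate, dominate the onward amplitudes driven by the same squares (one-sided Grönwall at the rate `ν(1+ε₀)^{2(N+1)}`).

The sequel `Theorems/SubOnsagerCeilingKPStarvedNetworkBarrier.lean`: the live gate fluxes starve, `(1+r)·∫LOUT_n ≤ ∫LOUT_{n-1}`, and
`ShellBarrierAt R ε₀ α` with `(1+ε₀)^{2θ} = 1 + r`, `D = (1+r)²`, at EVERY scale ratio when `r > ε₀`.
HONEST FRAMING: statements about Tao-type MODEL lattice ODEs (route SubOnsagerCeiling, rung TL-M2Break); one architecture class; no stub,
crux or summit is proved and nothing here bears on Navier–Stokes regularity. [cite: Tao2016AveragedNS, §4 (4.2)–(4.3), (4.8), (4.13)]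
[cite: Teschl2012, §2.4 (Grönwall)]
-/

noncomputable section

-- the sub-problem namespace `NavierStokesRegularity.NavierStokesRegularity` is the tree's layout (D-0017)
set_option linter.dupNamespace false

namespace Summit.NavierStokesRegularity.NavierStokesRegularity.Theorems

open Set Finset MeasureTheory intervalIntegral
open scoped Topology
open Literature.Analysis.FluidPDE.TaoCascade

section StarvedNetwork

variable {α : Fin 4 → Fin 4 → Fin 4 → ℤ × ℤ × ℤ → ℝ} {P : Fin 4 → Fin 4 → ℝ} {Q : Finset (Fin 4)}
  (hs : IsSymmetricCoeff α) (hc : IsCancellingCoeff α)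
  (hO : ∀ (Y : Fin 4 → ℤ → ℝ → ℝ) (τ : ℝ), (∀ (j : Fin 4) (k : ℤ), 1 ≤ k → 0 ≤ Y j k τ) →
    ∀ δ : ℝ, 0 < δ → ∀ (i : Fin 4) (n : ℤ), 1 ≤ n → Y i n τ = 0 → 0 ≤ quadTerm δ α Y i n τ)
  (hD : ∀ a b i : Fin 4, a ≠ b → α a b i (0, 0, 1) = 0)
  (hPump : ∀ a d : Fin 4, α a a d (0, 0, 0) = P a d)
  (hCz : ∀ a b d : Fin 4, a ≠ b → a ≠ d → b ≠ d → α a b d (0, 0, 0) = 0)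
  (hQw : ∀ d ∈ Q, ∀ e : Fin 4, α d d e (0, 0, 1) = 0)
  (hQP : ∀ d ∈ Q, ∀ j : Fin 4, P d j = 0)
  (hPQ : ∀ a j : Fin 4, j ∉ Q → P a j = 0)
include hs hc hO hD hPump hCz hQw hQP hPQ

omit hs hO hD hCz hQw hQP hPQ in
/-- The pump matrix has zero diagonal (`α a a a (0,0,0) = 0` by (4.3)). [cite: Tao2016AveragedNS, §4 (4.3)] -/
theorem starved_pump_diag (a : Fin 4) : P a a = 0 := by
  rw [← hPump]
  exact kpProper_inShell_diag_zero hc a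

omit hO hD hQw hQP hPQ in
/-- The in-shell coefficient table of a network without differential triads is determined by its pump matrix: pumps `P a i` at
`(a,a,i)`, back-reactions `−P a b/2` at `(a,b,a)` and `(b,a,a)`, nothing else. [cite: Tao2016AveragedNS, §4 (4.2)–(4.3)] -/
theorem starved_coeff (a b i : Fin 4) :
    α a b i (0, 0, 0) = (if a = b then P a i else 0) +
      (if a ≠ b ∧ i = a then -(P a b) / 2 else 0) + (if a ≠ b ∧ i = b then -(P b a) / 2 else 0) := by
  have hP0 : ∀ e : Fin 4, P e e = 0 := fun e => starved_pump_diag hc hPump e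
  have hdiag : ∀ e : Fin 4, α e e e (0, 0, 0) = 0 := fun e => kpProper_inShell_diag_zero hc e
  have hback : ∀ e j : Fin 4, e ≠ j → α e j e (0, 0, 0) = -(P e j) / 2 := by
    intro e j _
    have h1 := kpProper_inShell_back hc e j
    have h2 : α j e e (0, 0, 0) = α e j e (0, 0, 0) := hs j e e 0 0 0 kpProper_mem000
    rw [hPump] at h1
    linarith
  have hback' : ∀ e j : Fin 4, e ≠ j → α j e e (0, 0, 0) = -(P e j) / 2 := by
    intro e j hej
    rw [hs j e e 0 0 0 kpProper_mem000, hback e j hej]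
  by_cases hab : a = b
  · subst hab
    by_cases hia : i = a
    · subst hia
      simp [hdiag, hP0]
    · simp [hPump]
  · by_cases hia : i = a
    · subst hia
      simp [hab, hback i b hab]
    · by_cases hib : i = b
      · subst hib
        simp [hab, hia, hback' i a (Ne.symm hab)]
      · simp [hab, hia, hib, hCz a b i hab (Ne.symm hia) (Ne.symm hib)]

omit hO hD hQw hQP hPQ in
/-- The in-shell quadratic forms: `Σ_{a,b} α a b i (0,0,0)·y_a y_b = Σ_a P a i·y_a² − y_i·Σ_j P i j·y_j` (pumps received minus the
back-reaction of the pumps emitted). [cite: Tao2016AveragedNS, §4 (4.2)–(4.3)] -/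
theorem starved_inShell (y : Fin 4 → ℝ) (i : Fin 4) :
    ∑ a, ∑ b, α a b i (0, 0, 0) * (y a * y b) = ∑ a, P a i * y a ^ 2 - y i * ∑ j, P i j * y j := by
  have hP0 : ∀ e : Fin 4, P e e = 0 := fun e => starved_pump_diag hc hPump e
  simp only [starved_coeff hs hc hPump hCz, Fin.sum_univ_four]
  fin_cases i
  · simp [hP0]
    ring
  · simp [hP0]
    ring
  · simp [hP0]
    ring
  · simp [hP0]
    ring

omit hQw hQP hPQ in
/-- **Closed form of the nonlinearity of every mode** of a network without differential triads:
`quadTerm_i(n) = Λ_{n-1}Σ_a w_{ai}x²_{a,n-1} − Λₙ x_{i,n}Σ_j w_{ij}x_{j,n+1} + Λₙ(Σ_a P a i·x²_{a,n} − x_{i,n}Σ_j P i j·x_{j,n})`.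
[cite: Tao2016AveragedNS, §4 (4.8)] -/
theorem starved_quadTerm (ε₀ : ℝ) (X : Fin 4 → ℤ → ℝ → ℝ) (i : Fin 4) (n : ℤ) (t : ℝ) :
    quadTerm ε₀ α X i n t =
      (1 + ε₀) ^ ((5 : ℝ) * ((n : ℝ) - 1) / 2) * ∑ a, α a a i (0, 0, 1) * X a (n - 1) t ^ 2 -
        (1 + ε₀) ^ ((5 : ℝ) * n / 2) * (X i n t * ∑ j, α i i j (0, 0, 1) * X j (n + 1) t) +
        (1 + ε₀) ^ ((5 : ℝ) * n / 2) * (∑ a, P a i * X a n t ^ 2 - X i n t * ∑ j, P i j * X j n t) := by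
  rw [kpProper_quadTerm hs hc hO hD, starved_inShell hs hc hPump hCz (fun j => X j n t) i]

omit hPQ in
/-- **A pocket** `d ∈ Q` (feeds nothing, pumps nothing): `quadTerm_d(n) = Λ_{n-1}Σ_a w_{ad}x²_{a,n-1} + Λₙ Σ_a P a d·x²_{a,n}` — leaks
and pumps received, no drain. [cite: Tao2016AveragedNS, §4 (4.8)] -/
theorem starved_quadTerm_pocket (ε₀ : ℝ) (X : Fin 4 → ℤ → ℝ → ℝ) {d : Fin 4} (hd : d ∈ Q) (n : ℤ) (t : ℝ) :
    quadTerm ε₀ α X d n t =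
      (1 + ε₀) ^ ((5 : ℝ) * ((n : ℝ) - 1) / 2) * ∑ a, α a a d (0, 0, 1) * X a (n - 1) t ^ 2 +
        (1 + ε₀) ^ ((5 : ℝ) * n / 2) * ∑ a, P a d * X a n t ^ 2 := by
  rw [starved_quadTerm hs hc hO hD hPump hCz]
  simp [hQw d hd, hQP d hd]

omit hQw hQP in
/-- **A live mode** `e ∉ Q` (receives no pump): `quadTerm_e(n) = Λ_{n-1}Σ_a w_{ae}x²_{a,n-1} − Λₙ x_{e,n}Σ_j w_{ej}x_{j,n+1} −
Λₙ x_{e,n}Σ_j P e j·x_{j,n}`. [cite: Tao2016AveragedNS, §4 (4.8)] -/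
theorem starved_quadTerm_live (ε₀ : ℝ) (X : Fin 4 → ℤ → ℝ → ℝ) {e : Fin 4} (he : e ∉ Q) (n : ℤ) (t : ℝ) :
    quadTerm ε₀ α X e n t =
      (1 + ε₀) ^ ((5 : ℝ) * ((n : ℝ) - 1) / 2) * ∑ a, α a a e (0, 0, 1) * X a (n - 1) t ^ 2 -
        (1 + ε₀) ^ ((5 : ℝ) * n / 2) * (X e n t * ∑ j, α e e j (0, 0, 1) * X j (n + 1) t) -
        (1 + ε₀) ^ ((5 : ℝ) * n / 2) * (X e n t * ∑ j, P e j * X j n t) := by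
  rw [starved_quadTerm hs hc hO hD hPump hCz]
  have h0 : ∀ a, P a e = 0 := fun a => hPQ a e he
  simp [h0]
  ring

/-- **GRAM DOMINATION LEMMA.**  Along an honest non-negative `ν`-viscous solution from a one-shell datum (`ν ≥ 0`, `ε₀ ≥ 0`,
`P ≥ 0`, `r ≥ 0`) of a starved network whose exits GRAM-DOMINATE its onward feeds,
`r·Σ_{e∉Q} w_{ae}w_{ce} ≤ Σ_{d∈Q} (P a d·P c d + w_{ad}w_{cd})` for all live `a, c`: for every live `a`, every shell `N ≥ 1` and
`t ∈ [0,s]`, `r·Σ_{e∉Q} w_{ae}·x_{e,N+1}(t) ≤ Σ_{d∈Q} (P a d·x_{d,N}(t) + w_{ad}·x_{d,N+1}(t))`.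
(One-sided Grönwall on `e^{ν(1+ε₀)^{2(N+1)}t}·Z_a`, `Z_a = Σ_d (P a d·x_{d,N} + w_{ad}x_{d,N+1}) − rΣ_e w_{ae}x_{e,N+1}`: the pockets only
accumulate, the live modes one shell up are driven by the same squares `x²_{c,N}` and otherwise only drain.)
[cite: Teschl2012, §2.4 (Grönwall)] -/
theorem starved_domination {ε₀ ν s r : ℝ} (hε : 0 ≤ ε₀) (hν : 0 ≤ ν) (hr0 : 0 ≤ r) (hPnn : ∀ a d, 0 ≤ P a d)
    (hGram : ∀ a c : Fin 4, a ∉ Q → c ∉ Q →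
      r * ∑ e ∈ Qᶜ, α a a e (0, 0, 1) * α c c e (0, 0, 1) ≤
        ∑ d ∈ Q, (P a d * P c d + α a a d (0, 0, 1) * α c c d (0, 0, 1)))
    {X₀ : Fin 4 → ℝ} {X : Fin 4 → ℤ → ℝ → ℝ}
    (hdat : ∀ (i : Fin 4) (k : ℤ), X i k 0 = if k = 0 then X₀ i else 0)
    (hode : ∀ (i : Fin 4) (k : ℤ), ∀ t ∈ Icc (0 : ℝ) s, HasDerivWithinAt (X i k)
      (quadTerm ε₀ α X i k t - ν * (1 + ε₀) ^ ((2 : ℝ) * k) * X i k t) (Icc (0 : ℝ) s) t)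
    (hnn : ∀ t ∈ Icc (0 : ℝ) s, ∀ (i : Fin 4) (k : ℤ), 1 ≤ k → 0 ≤ X i k t)
    {a : Fin 4} (ha : a ∉ Q) {N : ℤ} (hN : 1 ≤ N) :
    ∀ t ∈ Icc (0 : ℝ) s, r * ∑ e ∈ Qᶜ, α a a e (0, 0, 1) * X e (N + 1) t ≤
      ∑ d ∈ Q, (P a d * X d N t + α a a d (0, 0, 1) * X d (N + 1) t) := by
  have hw0 : ∀ c i : Fin 4, 0 ≤ α c c i (0, 0, 1) := fun c i => kpProper_feed_nonneg hO c i
  set κ : ℝ := ν * (1 + ε₀) ^ ((2 : ℝ) * N) with hκ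
  set κ' : ℝ := ν * (1 + ε₀) ^ ((2 : ℝ) * ((N + 1 : ℤ) : ℝ)) with hκ'
  have hb1 : (1 : ℝ) ≤ 1 + ε₀ := by linarith
  have hκκ' : κ ≤ κ' := by
    simp only [hκ, hκ']
    refine mul_le_mul_of_nonneg_left (Real.rpow_le_rpow_of_exponent_le hb1 ?_) hν
    push_cast
    linarith
  have hκ'0 : 0 ≤ κ' := by positivity
  set u : ℝ → ℝ := fun τ => (∑ d ∈ Q, (P a d * X d N τ + α a a d (0, 0, 1) * X d (N + 1) τ)) -
    r * ∑ e ∈ Qᶜ, α a a e (0, 0, 1) * X e (N + 1) τ with hu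
  set u' : ℝ → ℝ := fun τ =>
    (∑ d ∈ Q, (P a d * (quadTerm ε₀ α X d N τ - κ * X d N τ) +
      α a a d (0, 0, 1) * (quadTerm ε₀ α X d (N + 1) τ - κ' * X d (N + 1) τ))) -
    r * ∑ e ∈ Qᶜ, α a a e (0, 0, 1) * (quadTerm ε₀ α X e (N + 1) τ - κ' * X e (N + 1) τ) with hu'
  have hud : ∀ τ ∈ Icc (0 : ℝ) s, HasDerivWithinAt u (u' τ) (Icc 0 s) τ := by
    intro τ hτ
    have h1 : ∀ d ∈ Q, HasDerivWithinAt (fun θ => P a d * X d N θ + α a a d (0, 0, 1) * X d (N + 1) θ)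
        (P a d * (quadTerm ε₀ α X d N τ - κ * X d N τ) +
          α a a d (0, 0, 1) * (quadTerm ε₀ α X d (N + 1) τ - κ' * X d (N + 1) τ)) (Icc 0 s) τ :=
      fun d _ => ((hode d N τ hτ).const_mul _).add ((hode d (N + 1) τ hτ).const_mul _)
    have h2 : ∀ e ∈ Qᶜ, HasDerivWithinAt (fun θ => α a a e (0, 0, 1) * X e (N + 1) θ)
        (α a a e (0, 0, 1) * (quadTerm ε₀ α X e (N + 1) τ - κ' * X e (N + 1) τ)) (Icc 0 s) τ :=
      fun e _ => (hode e (N + 1) τ hτ).const_mul _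
    exact (HasDerivWithinAt.fun_sum h1).sub ((HasDerivWithinAt.fun_sum h2).const_mul r)
  have hkey : ∀ τ ∈ Icc (0 : ℝ) s, 0 ≤ u' τ + κ' * u τ := by
    intro τ hτ
    have hΛ : 0 ≤ (1 + ε₀) ^ ((5 : ℝ) * N / 2) := Real.rpow_nonneg (by linarith) _
    have hΛm : 0 ≤ (1 + ε₀) ^ ((5 : ℝ) * ((N : ℝ) - 1) / 2) := Real.rpow_nonneg (by linarith) _
    have hΛ' : 0 ≤ (1 + ε₀) ^ ((5 : ℝ) * ((N + 1 : ℤ) : ℝ) / 2) := Real.rpow_nonneg (by linarith) _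
    have hxN : ∀ i, 0 ≤ X i N τ := fun i => hnn τ hτ i _ (by omega)
    have hxN1 : ∀ i, 0 ≤ X i (N + 1) τ := fun i => hnn τ hτ i _ (by omega)
    have hxN2 : ∀ i, 0 ≤ X i (N + 1 + 1) τ := fun i => hnn τ hτ i _ (by omega)
    have hidx : (N + 1 - 1 : ℤ) = N := by omega
    have hexp : ((5 : ℝ) * ((((N + 1 : ℤ)) : ℝ) - 1) / 2) = (5 : ℝ) * N / 2 := by push_cast; ring
    -- the common driver `Σ_c x²_{c,N}`-forms
    set SP : Fin 4 → ℝ := fun d => ∑ c, P c d * X c N τ ^ 2 with hSP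
    set SW : Fin 4 → ℝ := fun i => ∑ c, α c c i (0, 0, 1) * X c N τ ^ 2 with hSW
    -- (i) a pocket at shell `N` gains at least its pumps
    have hpocketN : ∀ d ∈ Q, (1 + ε₀) ^ ((5 : ℝ) * N / 2) * SP d ≤ quadTerm ε₀ α X d N τ := by
      intro d hd
      rw [starved_quadTerm_pocket hs hc hO hD hPump hCz hQw hQP ε₀ X hd]
      have : 0 ≤ (1 + ε₀) ^ ((5 : ℝ) * ((N : ℝ) - 1) / 2) * ∑ c, α c c d (0, 0, 1) * X c (N - 1) τ ^ 2 :=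
        mul_nonneg hΛm (Finset.sum_nonneg fun c _ => mul_nonneg (hw0 c d) (sq_nonneg _))
      linarith
    -- (ii) a pocket at shell `N+1` gains at least its leaks
    have hpocketN1 : ∀ d ∈ Q, (1 + ε₀) ^ ((5 : ℝ) * N / 2) * SW d ≤ quadTerm ε₀ α X d (N + 1) τ := by
      intro d hd
      rw [starved_quadTerm_pocket hs hc hO hD hPump hCz hQw hQP ε₀ X hd, hidx, hexp]
      have : 0 ≤ (1 + ε₀) ^ ((5 : ℝ) * ((N + 1 : ℤ) : ℝ) / 2) * ∑ c, P c d * X c (N + 1) τ ^ 2 :=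
        mul_nonneg hΛ' (Finset.sum_nonneg fun c _ => mul_nonneg (hPnn c d) (sq_nonneg _))
      linarith
    -- (iii) a live mode at shell `N+1` gains at most its feeds
    have hliveN1 : ∀ e ∈ Qᶜ, quadTerm ε₀ α X e (N + 1) τ ≤ (1 + ε₀) ^ ((5 : ℝ) * N / 2) * SW e := by
      intro e he
      rw [Finset.mem_compl] at he
      rw [starved_quadTerm_live hs hc hO hD hPump hCz hPQ ε₀ X he, hidx, hexp]
      have h1 : 0 ≤ (1 + ε₀) ^ ((5 : ℝ) * ((N + 1 : ℤ) : ℝ) / 2) *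
          (X e (N + 1) τ * ∑ j, α e e j (0, 0, 1) * X j (N + 1 + 1) τ) :=
        mul_nonneg hΛ' (mul_nonneg (hxN1 e) (Finset.sum_nonneg fun j _ => mul_nonneg (hw0 e j) (hxN2 j)))
      have h2 : 0 ≤ (1 + ε₀) ^ ((5 : ℝ) * ((N + 1 : ℤ) : ℝ) / 2) *
          (X e (N + 1) τ * ∑ j, P e j * X j (N + 1) τ) :=
        mul_nonneg hΛ' (mul_nonneg (hxN1 e) (Finset.sum_nonneg fun j _ => mul_nonneg (hPnn e j) (hxN1 j)))
      linarith
    -- the Gram bracket, mode by mode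
    have hbracket : ∀ c : Fin 4, 0 ≤ ((∑ d ∈ Q, P a d * P c d) + (∑ d ∈ Q, α a a d (0, 0, 1) * α c c d (0, 0, 1)) -
        r * ∑ e ∈ Qᶜ, α a a e (0, 0, 1) * α c c e (0, 0, 1)) * X c N τ ^ 2 := by
      intro c
      refine mul_nonneg ?_ (sq_nonneg _)
      by_cases hcQ : c ∈ Q
      · have h1 : ∑ d ∈ Q, P a d * P c d = 0 :=
          Finset.sum_eq_zero fun d _ => by rw [hQP c hcQ d]; ring
        have h1' : ∑ d ∈ Q, α a a d (0, 0, 1) * α c c d (0, 0, 1) = 0 :=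
          Finset.sum_eq_zero fun d _ => by rw [hQw c hcQ d]; ring
        have h2 : ∑ e ∈ Qᶜ, α a a e (0, 0, 1) * α c c e (0, 0, 1) = 0 :=
          Finset.sum_eq_zero fun e _ => by rw [hQw c hcQ e]; ring
        rw [h1, h1', h2]
        simp
      · have h := hGram a c ha hcQ
        rw [Finset.sum_add_distrib] at h
        linarith
    -- exchanging the sums
    have e1 : ∑ d ∈ Q, P a d * SP d = ∑ c, (∑ d ∈ Q, P a d * P c d) * X c N τ ^ 2 := by
      simp only [hSP, Finset.mul_sum, Finset.sum_mul]
      rw [Finset.sum_comm]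
      exact Finset.sum_congr rfl fun c _ => Finset.sum_congr rfl fun d _ => by ring
    have e2 : ∑ d ∈ Q, α a a d (0, 0, 1) * SW d = ∑ c, (∑ d ∈ Q, α a a d (0, 0, 1) * α c c d (0, 0, 1)) * X c N τ ^ 2 := by
      simp only [hSW, Finset.mul_sum, Finset.sum_mul]
      rw [Finset.sum_comm]
      exact Finset.sum_congr rfl fun c _ => Finset.sum_congr rfl fun d _ => by ring
    have e3 : ∑ e ∈ Qᶜ, α a a e (0, 0, 1) * SW e = ∑ c, (∑ e ∈ Qᶜ, α a a e (0, 0, 1) * α c c e (0, 0, 1)) * X c N τ ^ 2 := by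
      simp only [hSW, Finset.mul_sum, Finset.sum_mul]
      rw [Finset.sum_comm]
      exact Finset.sum_congr rfl fun c _ => Finset.sum_congr rfl fun d _ => by ring
    have hexch : (∑ d ∈ Q, (P a d * SP d + α a a d (0, 0, 1) * SW d)) - r * ∑ e ∈ Qᶜ, α a a e (0, 0, 1) * SW e =
        ∑ c, ((∑ d ∈ Q, P a d * P c d) + (∑ d ∈ Q, α a a d (0, 0, 1) * α c c d (0, 0, 1)) -
          r * ∑ e ∈ Qᶜ, α a a e (0, 0, 1) * α c c e (0, 0, 1)) * X c N τ ^ 2 := by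
      rw [Finset.sum_add_distrib, e1, e2, e3, Finset.mul_sum, ← Finset.sum_add_distrib, ← Finset.sum_sub_distrib]
      exact Finset.sum_congr rfl fun c _ => by ring
    have hsum0 : 0 ≤ (∑ d ∈ Q, (P a d * SP d + α a a d (0, 0, 1) * SW d)) -
        r * ∑ e ∈ Qᶜ, α a a e (0, 0, 1) * SW e := by
      rw [hexch]
      exact Finset.sum_nonneg fun c _ => hbracket c
    -- assembling `u' + κ' u`
    have hsimp : u' τ + κ' * u τ =
        (∑ d ∈ Q, (P a d * (quadTerm ε₀ α X d N τ + (κ' - κ) * X d N τ) +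
          α a a d (0, 0, 1) * quadTerm ε₀ α X d (N + 1) τ)) -
        r * ∑ e ∈ Qᶜ, α a a e (0, 0, 1) * quadTerm ε₀ α X e (N + 1) τ := by
      simp only [hu, hu', Finset.mul_sum, mul_sub, Finset.sum_sub_distrib, Finset.sum_add_distrib, mul_add]
      have e1 : ∑ d ∈ Q, P a d * ((κ' - κ) * X d N τ) = ∑ d ∈ Q, κ' * (P a d * X d N τ) - ∑ d ∈ Q, P a d * (κ * X d N τ) := by
        rw [← Finset.sum_sub_distrib]
        exact Finset.sum_congr rfl fun d _ => by ring
      have e2 : ∑ d ∈ Q, α a a d (0, 0, 1) * (κ' * X d (N + 1) τ) = ∑ d ∈ Q, κ' * (α a a d (0, 0, 1) * X d (N + 1) τ) :=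
        Finset.sum_congr rfl fun d _ => by ring
      have e3 : ∑ e ∈ Qᶜ, r * (α a a e (0, 0, 1) * (κ' * X e (N + 1) τ)) =
          κ' * ∑ e ∈ Qᶜ, r * (α a a e (0, 0, 1) * X e (N + 1) τ) := by
        rw [Finset.mul_sum]
        exact Finset.sum_congr rfl fun e _ => by ring
      rw [e1, e2, e3, Finset.mul_sum]
      ring
    rw [hsimp]
    -- lower bounds term by term
    have hL1 : ∑ d ∈ Q, (P a d * ((1 + ε₀) ^ ((5 : ℝ) * N / 2) * SP d) + α a a d (0, 0, 1) * ((1 + ε₀) ^ ((5 : ℝ) * N / 2) * SW d)) ≤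
        ∑ d ∈ Q, (P a d * (quadTerm ε₀ α X d N τ + (κ' - κ) * X d N τ) + α a a d (0, 0, 1) * quadTerm ε₀ α X d (N + 1) τ) := by
      refine Finset.sum_le_sum fun d hd => add_le_add ?_ ?_
      · have h3 : 0 ≤ (κ' - κ) * X d N τ := mul_nonneg (by linarith) (hxN d)
        exact mul_le_mul_of_nonneg_left (by linarith [hpocketN d hd]) (hPnn a d)
      · exact mul_le_mul_of_nonneg_left (hpocketN1 d hd) (hw0 a d)
    have hL2 : r * ∑ e ∈ Qᶜ, α a a e (0, 0, 1) * quadTerm ε₀ α X e (N + 1) τ ≤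
        r * ∑ e ∈ Qᶜ, α a a e (0, 0, 1) * ((1 + ε₀) ^ ((5 : ℝ) * N / 2) * SW e) :=
      mul_le_mul_of_nonneg_left (Finset.sum_le_sum fun e he => mul_le_mul_of_nonneg_left (hliveN1 e he) (hw0 a e)) hr0
    have hL3 : (∑ d ∈ Q, (P a d * ((1 + ε₀) ^ ((5 : ℝ) * N / 2) * SP d) + α a a d (0, 0, 1) * ((1 + ε₀) ^ ((5 : ℝ) * N / 2) * SW d))) -
        r * ∑ e ∈ Qᶜ, α a a e (0, 0, 1) * ((1 + ε₀) ^ ((5 : ℝ) * N / 2) * SW e) =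
        (1 + ε₀) ^ ((5 : ℝ) * N / 2) *
          ((∑ d ∈ Q, (P a d * SP d + α a a d (0, 0, 1) * SW d)) - r * ∑ e ∈ Qᶜ, α a a e (0, 0, 1) * SW e) := by
      rw [mul_sub, Finset.mul_sum, Finset.mul_sum, Finset.mul_sum, Finset.mul_sum]
      congr 1
      · exact Finset.sum_congr rfl fun d _ => by ring
      · exact Finset.sum_congr rfl fun e _ => by ring
    have hL4 : 0 ≤ (1 + ε₀) ^ ((5 : ℝ) * N / 2) *
        ((∑ d ∈ Q, (P a d * SP d + α a a d (0, 0, 1) * SW d)) - r * ∑ e ∈ Qᶜ, α a a e (0, 0, 1) * SW e) :=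
      mul_nonneg hΛ hsum0
    linarith
  set G : ℝ → ℝ := fun τ => Real.exp (κ' * τ) * u τ with hG
  set G' : ℝ → ℝ := fun τ => Real.exp (κ' * τ) * (u' τ + κ' * u τ) with hG'
  have hGd : ∀ τ ∈ Icc (0 : ℝ) s, HasDerivWithinAt G (G' τ) (Icc 0 s) τ := by
    intro τ hτ
    have hexp : HasDerivWithinAt (fun θ => Real.exp (κ' * θ)) (Real.exp (κ' * τ) * κ') (Icc 0 s) τ := by
      have := ((hasDerivAt_id τ).const_mul κ').exp
      simpa using this.hasDerivWithinAt
    have h := hexp.mul (hud τ hτ)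
    refine h.congr_deriv ?_
    simp only [hG']
    ring
  have hGmono : MonotoneOn G (Icc 0 s) := by
    have hGcont : ContinuousOn G (Icc 0 s) := fun τ hτ => (hGd τ hτ).continuousWithinAt
    refine monotoneOn_of_hasDerivWithinAt_nonneg (f' := G') (convex_Icc 0 s) hGcont ?_ ?_
    · intro x hx
      rw [interior_Icc] at hx ⊢
      exact (hGd x (Ioo_subset_Icc_self hx)).mono Ioo_subset_Icc_self
    · intro x hx
      rw [interior_Icc] at hx
      exact mul_nonneg (Real.exp_pos _).le (hkey x (Ioo_subset_Icc_self hx))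
  have hG0 : G 0 = 0 := by
    have h1 : ∀ i, X i N 0 = 0 := fun i => by rw [hdat]; simp; omega
    have h2 : ∀ i, X i (N + 1) 0 = 0 := fun i => by rw [hdat]; simp; omega
    simp [hG, hu, h1, h2]
  intro t ht
  have hGt : 0 ≤ G t := by
    rw [← hG0]
    exact hGmono ⟨le_rfl, ht.1.trans ht.2⟩ ht ht.1
  have hexp : 0 < Real.exp (κ' * t) := Real.exp_pos _
  have hut : 0 ≤ u t := by
    by_contra hh
    push Not at hh
    have : G t < 0 := by simp only [hG]; nlinarith [mul_pos hexp (neg_pos.2 hh)]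
    linarith
  simp only [hu] at hut
  linarith

end StarvedNetwork

end Summit.NavierStokesRegularity.NavierStokesRegularity.Theorems

end
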